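import Summits.BirchSwinnertonDyer.BirchSwinnertonDyer.Theorems.ManinLocalTwoThreePShiftEigenAllLevels
import HarnessLib

/-!
# The prime-generic eigen law, eigenvalue ZERO: `K^0_p(N) = 0` for `p ≥ 5` (and the eigen law for every `ε ≠ 1`)
# (route `ManinLocalTwoThree`, cell bsd-f2-manin; cruxes C2 stmt-BirchSwinnertonDyer-22967 / C3 stmt-…-22968; LEAD seat p1 gen 12)

`K^0_p(N)` is the space of additive `φ : Γ₀(N) → ℤ/p` with `φ(a, pb; c, d) = 0`, i.e. vanishing on `A = {p ∣ b}`.  For `p ∤ N` it is `0`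
by p2's Serre rigidity (`shiftEigenTrivialAtP_of_not_dvd`, `ζ = 0 ≠ 1`).  For `p ∣ N` and `p ≥ 5` it is `0` by an elementary argument:
`γ T^{−k} ∈ A` for `k ≡ b_γ/a_γ (mod p)`, so `φ(γ) = k·φ(T)`; and for `g ∈ Γ₀(N)` with `a_g ≡ 2 (mod p)` (CRT), `gTg⁻¹ = (1−ac, a²; −c², 1+ac)`
gives `φ(T) = a²φ(T) = 4φ(T)`, so `3φ(T) = 0`, `φ(T) = 0`.  (At `p = 3` this FAILS: `β = a·b mod 3` is additive on `Γ₀(3m)` and kills `A` —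
the engine's exponent map; at `p = 2` likewise.)  Hence **`shiftEigenTrivialAtP_zero`** and the eigen law for EVERY `ε ≠ 1`:
**`shiftEigenTrivialAtP_all_of_ne_one (h5 : 5 ≤ p) (hε1 : ε ≠ 1) : ∀ N ≥ 1, ShiftEigenTrivialAtP p N ε`**.
Nothing about BSD, Manin's conjecture or C2/C3 is asserted (structure theorem about `Γ₀(N)`).
[cite: DarmonDiamondTaylor1995, Lemma 4.28 (p. 135) (shape only)]
-/

set_option autoImplicit false
set_option linter.dupNamespace false

open scoped MatrixGroups

open CongruenceSubgroup Matrix.SpecialLinearGroup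
  Summit.BirchSwinnertonDyer.Rank1Residual.ManinAdditive.NineShiftEqualiser

namespace Summit.BirchSwinnertonDyer.BirchSwinnertonDyer.Theorems.ManinLocalTwoThree

namespace PShiftEngine

open ThreeShiftDescent TwoShift PShiftTransfer

variable {p : ℕ} [Fact p.Prime]

/-- CRT: an element `(a b; c d) ∈ Γ₀(N)` (`N ≥ 1`) with `a ≡ 2 (mod p)`. [folklore] -/
theorem exists_g0Of_fst_two {N : ℕ} (hN : 0 < N) (hp3 : 3 ≤ p) :
    ∃ (a b c d : ℤ) (_ : a * d - b * c = 1) (_ : (N : ℤ) ∣ c), (p : ℤ) ∣ a - 2 := by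
  have hp : p.Prime := Fact.out
  have hco : p.Coprime (ordCompl[p] N) := Nat.coprime_ordCompl hp hN.ne'
  obtain ⟨k, hk2, hk1⟩ := Nat.chineseRemainder hco 2 1
  have hpk : ¬ p ∣ k := by
    intro hdvd
    have h2 : (p : ℤ) ∣ 2 := by
      have := hk2.dvd
      have hk : (p : ℤ) ∣ (k : ℤ) := Int.natCast_dvd_natCast.mpr hdvd
      have := dvd_add this hk
      simpa using this
    have : p ∣ 2 := by exact_mod_cast h2
    have := Nat.le_of_dvd two_pos this
    omega
  have hkp : Nat.Coprime k (ordProj[p] N) := (Nat.Coprime.pow_right _ ((hp.coprime_iff_not_dvd.mpr hpk).symm))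
  have hkN₀ : Nat.Coprime k (ordCompl[p] N) := by
    unfold Nat.Coprime; rw [hk1.gcd_eq, Nat.gcd_one_left]
  have hkN : Nat.Coprime k N := by
    rw [← Nat.ordProj_mul_ordCompl_eq_self N p]; exact Nat.Coprime.mul_right hkp hkN₀
  obtain ⟨u, v, huv⟩ := Nat.isCoprime_iff_coprime.mpr hkN
  refine ⟨k, -v, N, u, by linear_combination huv, dvd_rfl, ?_⟩
  have h2k : (p : ℤ) ∣ (2 : ℤ) - k := by have := hk2.dvd; push_cast at this; exact this
  have e : ((k : ℤ)) - 2 = -((2 : ℤ) - k) := by ring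
  rw [e]; exact h2k.neg_right

variable {m : ℕ}

/-- **`K^0_p(pm) = 0` for `p ≥ 5`, `m ≥ 1`**: an additive `φ : Γ₀(pm) → ℤ/p` vanishing on `{p ∣ b}` vanishes. [new: elementary] -/
theorem shiftEigenTrivialAtP_zero_mul (h5 : 5 ≤ p) (hm : 0 < m) : ShiftEigenTrivialAtP p (p * m) (0 : ZMod p) := by
  have hp : p.Prime := Fact.out
  intro φ hadd hinv
  -- φ vanishes on `A = stabZero`
  have h0 : ∀ x ∈ stabZero p (p * m), φ x = 0 := by
    intro x hx
    obtain ⟨a, b, c, d, h, hc, rfl⟩ := exists_eq_of_mem_stabZero hx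
    have := hinv a b c d (by linear_combination h) hc
    rw [zero_mul] at this
    exact this
  have hadd' : ∀ x ∈ (⊤ : Subgroup (Gamma0 (p * m))), ∀ y ∈ (⊤ : Subgroup (Gamma0 (p * m))), φ (x * y) = φ x + φ y :=
    fun x _ y _ => hadd x y
  -- `φ(γ) = k φ(T)` whenever `γ T^{-k} ∈ A`
  have hT : ∀ (γ : Gamma0 (p * m)) (k : ℤ), γ * Tpow (p * m) (-k) ∈ stabZero p (p * m) → φ γ = k • φ (Tpow (p * m) 1) := by
    intro γ k hk
    have e : γ = (γ * Tpow (p * m) (-k)) * Tpow (p * m) k := by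
      rw [mul_assoc, Tpow_mul_Tpow, neg_add_cancel, Tpow_zero, mul_one]
    rw [e, hadd, h0 _ hk, zero_add, ← Tpow_one_zpow, addOn_map_zpow hadd' (Subgroup.mem_top _)]
  -- `φ(T) = 0` by conjugating with `g`, `a_g ≡ 2 (mod p)`
  obtain ⟨a, b, c, d, h, hc, hap⟩ := exists_g0Of_fst_two (p := p) (N := p * m) (Nat.mul_pos hp.pos hm) (by omega)
  have hpc : (p : ℤ) ∣ c := dvd_trans ⟨(m : ℤ), by push_cast; ring⟩ hc
  have hcc : ((p * m : ℕ) : ℤ) ∣ -(c * c) := by rw [dvd_neg]; exact Dvd.dvd.mul_left hc c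
  set g : Gamma0 (p * m) := g0Of a b c d h hc with hg
  set X : Gamma0 (p * m) := g0Of (1 - a * c) (a * a) (-(c * c)) (1 + a * c) (by ring) hcc with hX
  have hconj : g * Tpow (p * m) 1 = X * g := by
    rw [hg, hX, g0Of_mul_Tpow a b c d h hc 1 (by linear_combination h),
      g0Of_mul _ _ _ _ a b c d _ _ h hc (by linear_combination h) (by
        have : -(c * c) * a + (1 + a * c) * c = c := by ring
        rw [this]; exact hc)]
    exact g0Of_congr (by ring) (by linear_combination (-a) * h) (by ring) (by linear_combination (-c) * h) _ _ _ _
  have hφX : φ X = φ (Tpow (p * m) 1) := by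
    have := congrArg φ hconj
    rw [hadd, hadd] at this
    -- `φ g + φ T = φ X + φ g`
    linear_combination -this
  have hXk : X * Tpow (p * m) (-(a * a)) ∈ stabZero p (p * m) := by
    rw [hX, g0Of_mul_Tpow _ _ _ _ _ hcc (-(a * a)) (by ring)]
    obtain ⟨c₀, hc₀⟩ := hpc
    exact mem_stabZero_iff.mpr ⟨a * a * a * c₀, by simp only [g0Of, slOf_apply_01]; rw [hc₀]; ring⟩
  have hTval := hT X (a * a) hXk
  rw [hφX] at hTval
  -- `φ T = a² φ T`, `a ≡ 2`: `3 φ T = 0`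
  have ha2 : ((a : ℤ) : ZMod p) = 2 := by
    obtain ⟨t, ht⟩ := hap
    have : (a : ℤ) = 2 + p * t := by linear_combination ht
    rw [this]; push_cast; rw [ZMod.natCast_self, zero_mul, add_zero]
  have h3 : (3 : ZMod p) ≠ 0 := by
    have : ((3 : ℕ) : ZMod p) ≠ 0 := by
      rw [Ne, ZMod.natCast_eq_zero_iff]; intro h3; have := Nat.le_of_dvd (by norm_num) h3; omega
    simpa using this
  have hT0 : φ (Tpow (p * m) 1) = 0 := by
    have e : ((a * a : ℤ) : ZMod p) * φ (Tpow (p * m) 1) = φ (Tpow (p * m) 1) := by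
      rw [← zsmul_eq_mul]; exact hTval.symm
    push_cast at e
    rw [ha2] at e
    have : (3 : ZMod p) * φ (Tpow (p * m) 1) = 0 := by linear_combination e
    rcases mul_eq_zero.mp this with h' | h'
    · exact absurd h' h3
    · exact h'
  -- any `γ`: `p ∤ a_γ`, so `γ T^{-k} ∈ A` for suitable `k`
  intro γ
  obtain ⟨a', b', c', d', h', hc', rfl⟩ := CubeStep.exists_eq_g0Of γ
  have hpc' : (p : ℤ) ∣ c' := dvd_trans ⟨(m : ℤ), by push_cast; ring⟩ hc'
  obtain ⟨c₁, hc₁⟩ := hpc'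
  have hcop : IsCoprime a' (p : ℤ) := ⟨d', -(b' * c₁), by linear_combination h' + b' * hc₁⟩
  obtain ⟨u', v', huv'⟩ := hcop
  have hk : g0Of a' b' c' d' h' hc' * Tpow (p * m) (-(b' * u')) ∈ stabZero p (p * m) := by
    rw [g0Of_mul_Tpow _ _ _ _ h' hc' _ (by linear_combination h')]
    exact mem_stabZero_iff.mpr ⟨b' * v', by simp only [g0Of, slOf_apply_01]; linear_combination (-b') * huv'⟩
  rw [hT _ _ hk, hT0, smul_zero]

/-- **`K^0_p(N) = 0` for every `N ≥ 1`, `p ≥ 5`.** [new] -/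
theorem shiftEigenTrivialAtP_zero (h5 : 5 ≤ p) (N : ℕ) (hN : 0 < N) : ShiftEigenTrivialAtP p N (0 : ZMod p) := by
  by_cases hpN : p ∣ N
  · obtain ⟨m, rfl⟩ := hpN
    exact shiftEigenTrivialAtP_zero_mul h5 (Nat.pos_of_mul_pos_left hN)
  · exact shiftEigenTrivialAtP_of_not_dvd hN hpN zero_ne_one

/-- **THE EIGEN LAW FOR EVERY `ε ≠ 1`** (`p ≥ 5`, every `N ≥ 1`, coefficients `ℤ/p`): `K^ε_p(N) = 0`. [new: assembly] -/
theorem shiftEigenTrivialAtP_all_of_ne_one (h5 : 5 ≤ p) {ε : ZMod p} (hε1 : ε ≠ 1) (N : ℕ) (hN : 0 < N) :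
    ShiftEigenTrivialAtP p N ε := by
  by_cases hε0 : ε = 0
  · subst hε0; exact shiftEigenTrivialAtP_zero h5 N hN
  · exact shiftEigenTrivialAtP_all h5 hε0 hε1 N hN

end PShiftEngine

end Summit.BirchSwinnertonDyer.BirchSwinnertonDyer.Theorems.ManinLocalTwoThree
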